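import Summits.QuantumAdvantage.AdviceFreeQNC0.RingHardOdd
import Summits.QuantumAdvantage.AdviceFreeQNC0.RingCanonical
import Summits.QuantumAdvantage.AdviceFreeQNC0.OddPrimeTransport
import Literature.Computability.MetaComplexity.ModmVersusF2Polynomials
import HarnessLib

/-!
# Cell qa-qnc0, FRAME AVERAGING — the domination principle (ROUND-21 §4.7): statements VERBATIM and the bookkeeping half —
planner qa-qnc0-p1 g22, `Sketch22.lean` §2c (ask P-22g)

Support for crux `RingDenseResidualLt3` (stmt-QuantumAdvantage-22907), route `DWalkThree`.  A frame ⊗ junta strategy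
`z_k(x) = τ_k(Vx, x|_{T_k})` over a regular frame is dominated by the AVERAGE of its `3^m` frozen junta strategies
(`FrameAveraging`); frozen strategies are global `w₀`-juntas, hence polylog-degree `𝔽₂`-polynomial maps, hence losers by
the TREE THEOREM `ringHardOdd_two : RingHardOdd 2` (`OddPrimeTransport`).

Objects VERBATIM from the planner's `exp22/Sketch22.lean` §2c: `frameVal`, `ReadsOnly`, `frameJuntaBell`, `frozenBell`,
`winCount`, `FrameAveraging`, `FrameAveragingOne`, `CharVsProduct`, `Mod3VsLowDegree`, `JuntaHardOfTwo`, `RingFrameJuntaLt3`,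
`FrameJuntaOfAveraging`, `RingFrameJuntaCommonLt3`, `FrameJuntaOfCommon`.

PROVED here (0 sorry):
* `charVsProduct : CharVsProduct`, `mod3VsLowDegree : Mod3VsLowDegree` — one token each over qn-lit's Literature theorems
  `TwoModuli.charVsProduct`, `TwoModuli.mod3VsLowDegree` (p611623, [ViolaWigderson2008] Thm 2.9 for the latter);
* **`juntaHardOfTwo : JuntaHardOfTwo`** and the unconditional **`juntaHard`**: ONE `θ₂ < 1` for all `w₀`-junta strategies with
  arbitrary wiring (`N ≥ max(n₀, 2^{w₀})`) — a `T_k`-junta indicator is an `𝔽₂`-polynomial of degree `≤ |T_k| ≤ log₂ N`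
  (`TwoModuli.mem_degLE_card_of_forall_eq`, `smolensky_lowDeg_eq_degLE`) and `ringHardOdd_two` applies;
* **`frameJuntaOfAveraging : FrameJuntaOfAveraging`**, `frameJuntaOfCommon : FrameJuntaOfCommon` (bookkeeping) and the
  CONDITIONAL rung **`ringFrameJuntaLt3_of : FrameAveraging → RingFrameJuntaLt3`** — after this file the rung
  `RingFrameJuntaLt3` hinges on `FrameAveraging` alone.

WHAT THIS IS NOT: `FrameAveraging` / `FrameAveragingOne` (the identity + error bounds) are NOT proved here; nothing touches the
crux; `RingFrameJuntaCommonLt3` is only stated.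
-/

namespace Summit.QuantumAdvantage.AdviceFreeQNC0

open Finset Literature.Computability.QuantumComplexity Literature.Computability.QuantumComplexity.RingHLF
open Literature.Computability.MetaComplexity

namespace AffBells22

/-! ## §2c statements (planner qa-qnc0-p1 g22, Sketch22.lean §2c — VERBATIM) -/

/-- The frame value `Vx ∈ 𝔽₃^m` of an input. -/
def frameVal {N m : ℕ} (V : Fin m → Fin N → ZMod 3) (x : Fin N → Bool) : Fin m → ZMod 3 :=
  fun l => ∑ i : Fin N, if x i then V l i else 0

/-- `g` reads only the bits in `T`. -/
def ReadsOnly {N : ℕ} (T : Finset (Fin N)) (g : (Fin N → Bool) → Bool) : Prop :=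
  ∀ x x' : Fin N → Bool, (∀ i ∈ T, x i = x' i) → g x = g x'

/-- The frame ⊗ junta strategy `z_k(x) = τ_k(Vx, x)` (`τ_k(y, ·)` a `T_k`-junta). -/
def frameJuntaBell {N m : ℕ} (V : Fin m → Fin N → ZMod 3) (τ : Fin N → (Fin m → ZMod 3) → (Fin N → Bool) → Bool)
    (x : Fin N → Bool) : Fin N → Bool :=
  fun k => τ k (frameVal V x) x

/-- The frozen strategy `z^{[u]}_k(x) = τ_k(u, x)`. -/
def frozenBell {N m : ℕ} (τ : Fin N → (Fin m → ZMod 3) → (Fin N → Bool) → Bool) (u : Fin m → ZMod 3)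
    (x : Fin N → Bool) : Fin N → Bool :=
  fun k => τ k u x

/-- Number of odd patterns on which a strategy satisfies the ring relation. -/
noncomputable def winCount {N : ℕ} (z : (Fin N → Bool) → Fin N → Bool) : ℕ :=
  open scoped Classical in
  (univ.filter fun x : Fin N → Bool => OddZeros x ∧ RingHLF.Rel x (z x)).card

/-- **FRAME AVERAGING** (support; THE domination theorem): a frame ⊗ junta strategy over a regular frame of dimension `≤ μ₀N`
wins at most `ε·2^{N−1}` more often than the AVERAGE of its `3^m` frozen junta strategies.  (`w₀ ≤ 1`: elementary product
bound, `AffBells22FrameAveragingOne.lean`; general `w₀`: PROVED in `AffBells22FrameAveraging.lean` (`frameAveraging`) via Lemma JPD —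
junta-product decorrelation on the kernel-line fibres along a Turán transversal, `AffBells23JuntaProduct.lean` — WITHOUT
`Mod3VsLowDegree`/Viola–Wigderson; docstring updated 2026-08-28 per qa-qnc0-ref W-R64-2.) -/
def FrameAveraging : Prop :=
  ∀ δ : ℝ, 0 < δ → ∀ w₀ : ℕ, ∀ ε : ℝ, 0 < ε → ∃ μ₀ : ℝ, 0 < μ₀ ∧ ∃ n₀ : ℕ, ∀ N ≥ n₀, ∀ m : ℕ, (m : ℝ) ≤ μ₀ * N →
    ∀ (V : Fin m → Fin N → ZMod 3) (T : Fin N → Finset (Fin N))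
      (τ : Fin N → (Fin m → ZMod 3) → (Fin N → Bool) → Bool),
      (∀ t : Fin m → ZMod 3, t ≠ 0 → δ * N ≤ ((univ.filter fun i : Fin N => (∑ l : Fin m, t l * V l i) ≠ 0).card : ℝ)) →
      (∀ k, (T k).card ≤ w₀) → (∀ k y, ReadsOnly (T k) (τ k y)) →
      (winCount (frameJuntaBell V τ) : ℝ)
        ≤ (∑ u : Fin m → ZMod 3, (winCount (frozenBell τ u) : ℝ)) / (3 : ℝ) ^ m + ε * (2 : ℝ) ^ (N - 1)

/-- The same for `w₀ ≤ 1` only (support; fully elementary: identity + product bound + `KernelZerosOnSetMGF`). -/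
def FrameAveragingOne : Prop :=
  ∀ δ : ℝ, 0 < δ → ∀ ε : ℝ, 0 < ε → ∃ μ₀ : ℝ, 0 < μ₀ ∧ ∃ n₀ : ℕ, ∀ N ≥ n₀, ∀ m : ℕ, (m : ℝ) ≤ μ₀ * N →
    ∀ (V : Fin m → Fin N → ZMod 3) (T : Fin N → Finset (Fin N))
      (τ : Fin N → (Fin m → ZMod 3) → (Fin N → Bool) → Bool),
      (∀ t : Fin m → ZMod 3, t ≠ 0 → δ * N ≤ ((univ.filter fun i : Fin N => (∑ l : Fin m, t l * V l i) ≠ 0).card : ℝ)) →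
      (∀ k, (T k).card ≤ 1) → (∀ k y, ReadsOnly (T k) (τ k y)) →
      (winCount (frameJuntaBell V τ) : ℝ)
        ≤ (∑ u : Fin m → ZMod 3, (winCount (frozenBell τ u) : ℝ)) / (3 : ℝ) ^ m + ε * (2 : ℝ) ^ (N - 1)

/-- **CHARACTER vs PRODUCT** (support, the `w₀ ≤ 1` error lemma; one line per coordinate, `|1 + s·ω^{a}|/2 ≤ √3/2` for `a ≠ 0`,
`s = ±1`): `|Σ_F ω^{⟨γ,F⟩} Π_p s_p^{F_p}| ≤ 2^q (√3/2)^{wt γ}`. -/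
def CharVsProduct : Prop :=
  ∀ (q : ℕ) (γ : Fin q → ZMod 3) (s : Fin q → Bool),
    ‖∑ F : Fin q → Bool, Complex.exp (2 * Real.pi * Complex.I / 3) ^ (∑ p, if F p then (γ p).val else 0) *
        (∏ p, if F p ∧ s p then (-1 : ℂ) else 1)‖
      ≤ (2 : ℝ) ^ q * (Real.sqrt 3 / 2) ^ (univ.filter fun p => γ p ≠ 0).card

/-- **MOD₃ CHARACTERS vs LOW 𝔽₂-DEGREE** (Literature fact to type — [Bourgain 2005, Green–Roy–Straubing 2005, Viola–Wigderson
Theory Comput. 4 (2008) Thm 1.?]; exact constants for qn-lit, ask L-24): a nontrivial MOD₃ character of full support has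
exponentially small correlation with `(−1)^{g}`, `deg g ≤ d`. -/
def Mod3VsLowDegree : Prop :=
  ∀ d : ℕ, ∃ c : ℝ, 0 < c ∧ ∃ n₀ : ℕ, ∀ n ≥ n₀, ∀ (a : Fin n → ZMod 3) (g : Smolensky.CubeFn (ZMod 2) n),
    (∀ i, a i ≠ 0) → g ∈ Smolensky.lowDeg (ZMod 2) n d →
      ‖∑ x : Fin n → Bool, Complex.exp (2 * Real.pi * Complex.I / 3) ^ (∑ i, if x i then (a i).val else 0) *
          (if g x = 1 then (-1 : ℂ) else 1)‖ ≤ (2 : ℝ) ^ n * Real.exp (-(c * n))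

/-- **JUNTA STRATEGIES ARE HARD — a COROLLARY of the tree theorem `ringHardOdd_two`** (support; a `w₀`-junta Boolean function is an
`𝔽₂`-polynomial of degree `≤ w₀ ≤ log₂ N`): one `θ₂ < 1` for all junta strategies with arbitrary wiring. -/
def JuntaHardOfTwo : Prop :=
  RingHardOdd 2 →
    ∃ θ : ℝ, θ < 1 ∧ ∀ w₀ : ℕ, ∃ n₀ : ℕ, ∀ N ≥ n₀, ∀ (T : Fin N → Finset (Fin N)) (g : Fin N → (Fin N → Bool) → Bool),
      (∀ k, (T k).card ≤ w₀) → (∀ k, ReadsOnly (T k) (g k)) →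
        (winCount (fun x k => g k x) : ℝ) ≤ θ * (2 : ℝ) ^ (N - 1)

/-- **RUNG `RingFrameJuntaLt3` (R-frame⊗junta)** — every strategy whose outputs are arbitrary functions of a `δN`-regular frame
value of dimension `≤ μ₀N` and of `≤ w₀` own input bits satisfies the ring relation on at most `θ·2^{N−1}` odd patterns.
Strictly contains `RingFrameAffineLt3` (w₀ = 0, affine tables) and the regular-frame part of EXIT; not restricted to the affine
face (M2). -/
def RingFrameJuntaLt3 : Prop :=
  ∀ δ : ℝ, 0 < δ → ∀ w₀ : ℕ, ∃ μ₀ : ℝ, 0 < μ₀ ∧ ∃ θ : ℝ, θ < 1 ∧ ∃ n₀ : ℕ, ∀ N ≥ n₀, ∀ m : ℕ, (m : ℝ) ≤ μ₀ * N →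
    ∀ (V : Fin m → Fin N → ZMod 3) (T : Fin N → Finset (Fin N))
      (τ : Fin N → (Fin m → ZMod 3) → (Fin N → Bool) → Bool),
      (∀ t : Fin m → ZMod 3, t ≠ 0 → δ * N ≤ ((univ.filter fun i : Fin N => (∑ l : Fin m, t l * V l i) ≠ 0).card : ℝ)) →
      (∀ k, (T k).card ≤ w₀) → (∀ k y, ReadsOnly (T k) (τ k y)) →
      (winCount (frameJuntaBell V τ) : ℝ) ≤ θ * (2 : ℝ) ^ (N - 1)

/-- The assembly of §2c (support, pure bookkeeping: `win ≤ avg + ε2^{N−1} ≤ (θ₂ + ε)2^{N−1}`, `ε = (1−θ₂)/2`). -/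
def FrameJuntaOfAveraging : Prop := FrameAveraging → JuntaHardOfTwo → RingHardOdd 2 → RingFrameJuntaLt3

/-- **RUNG `RingFrameJuntaCommonLt3` (R-frame⊗junta with a COMMON polylog junta set)** — as `RingFrameJuntaLt3`, but every table may in
addition read a COMMON set `J₀` of `≤ (log₂ N)^C` input bits, and regularity of the frame is only required OFF `J₀`.  Same proof: the frozen
strategies read `≤ w₀ + (log₂N)^C` bits each (polylog `𝔽₂`-degree, so `ringHardOdd_two` applies), and in the error term one conditions on the
coins inside `J₀` (for each value the rest is a product of `w₀`-local factors; the character keeps weight `≥ wt(tV|_P) − |J₀|`).  This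
removes "juntas on a common large set → conditioning" from the open list of ROUND-21 §4.7 for `|J₀| ≤ polylog`. -/
def RingFrameJuntaCommonLt3 : Prop :=
  ∀ δ : ℝ, 0 < δ → ∀ w₀ C : ℕ, ∃ μ₀ : ℝ, 0 < μ₀ ∧ ∃ θ : ℝ, θ < 1 ∧ ∃ n₀ : ℕ, ∀ N ≥ n₀, ∀ m : ℕ, (m : ℝ) ≤ μ₀ * N →
    ∀ (V : Fin m → Fin N → ZMod 3) (J₀ : Finset (Fin N)) (T : Fin N → Finset (Fin N))
      (τ : Fin N → (Fin m → ZMod 3) → (Fin N → Bool) → Bool),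
      (J₀.card ≤ (Nat.log 2 N) ^ C) →
      (∀ t : Fin m → ZMod 3, t ≠ 0 →
        δ * N ≤ ((univ.filter fun i : Fin N => i ∉ J₀ ∧ (∑ l : Fin m, t l * V l i) ≠ 0).card : ℝ)) →
      (∀ k, (T k).card ≤ w₀) → (∀ k y, ReadsOnly (T k ∪ J₀) (τ k y)) →
      (winCount (frameJuntaBell V τ) : ℝ) ≤ θ * (2 : ℝ) ^ (N - 1)

/-- `RingFrameJuntaCommonLt3 → RingFrameJuntaLt3` (take `J₀ = ∅`; bookkeeping). -/
def FrameJuntaOfCommon : Prop := RingFrameJuntaCommonLt3 → RingFrameJuntaLt3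

/-! ## The two Literature facts, one token each (qn-lit g24, p611623) -/

/-- **`CharVsProduct` PROVED** — it is `TwoModuli.charVsProduct` ([ChattopadhyayWigderson2009] separation of variables). -/
theorem charVsProduct : CharVsProduct := TwoModuli.charVsProduct

/-- **`Mod3VsLowDegree` PROVED** — it is `TwoModuli.mod3VsLowDegree` ([ViolaWigderson2008] Thm 2.9, `c = 3/(8·4^d)`). -/
theorem mod3VsLowDegree : Mod3VsLowDegree := TwoModuli.mod3VsLowDegree

/-! ## Junta strategies are hard -/

/-- A `T`-junta Boolean function, as an `𝔽₂`-valued indicator, has `𝔽₂`-degree `≤ |T|`. -/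
theorem indicator_mem_lowDeg {N : ℕ} (T : Finset (Fin N)) (g : (Fin N → Bool) → Bool) (hg : ReadsOnly T g) :
    (fun x : Fin N → Bool => if g x then (1 : ZMod 2) else 0) ∈ Smolensky.lowDeg (ZMod 2) N T.card := by
  rw [TwoModuli.smolensky_lowDeg_eq_degLE]
  exact TwoModuli.mem_degLE_card_of_forall_eq T (fun x y h => by rw [hg x y h])

/-- **`JuntaHardOfTwo` PROVED**: `θ = θ₂` of `RingHardOdd 2` (taken at degree exponent `c = 1`), `n₀(w₀) = max(n₀(1), 2^{w₀})`. -/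
theorem juntaHardOfTwo : JuntaHardOfTwo := by
  intro hR
  classical
  obtain ⟨θ, hθ, hall⟩ := hR
  refine ⟨θ, hθ, fun w₀ => ?_⟩
  obtain ⟨n₀, hn₀⟩ := hall 1
  refine ⟨max n₀ (2 ^ w₀), fun N hN T g hT hread => ?_⟩
  have hNn₀ : n₀ ≤ N := le_trans (le_max_left _ _) hN
  have hlog : w₀ ≤ Nat.log 2 N := Nat.le_log_of_pow_le (by norm_num) (le_trans (le_max_right _ _) hN)
  -- the strategy as an `𝔽₂`-polynomial map of degree ≤ log₂ N
  set P : Fin N → Smolensky.CubeFn (ZMod 2) N := fun k x => if g k x then 1 else 0 with hP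
  have hdeg : ∀ k, P k ∈ Smolensky.lowDeg (ZMod 2) N ((Nat.log 2 N) ^ 1) := by
    intro k
    rw [pow_one]
    exact Smolensky.lowDeg_mono (le_trans (hT k) hlog) (indicator_mem_lowDeg (T k) (g k) (hread k))
  have h := hn₀ N hNn₀ P hdeg
  have hfun : ∀ x : Fin N → Bool, (fun i => decide (P i x = 1)) = fun k => g k x := by
    intro x
    funext k
    simp only [hP]
    by_cases hgk : g k x = true
    · simp [hgk]
    · simp [hgk]
  have hset : ((univ : Finset (Fin N → Bool)).filter fun x => OddZeros x ∧ RingHLF.Rel x (fun k => g k x))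
      = (univ : Finset (Fin N → Bool)).filter fun x => OddZeros x ∧ RingHLF.Rel x (fun i => decide (P i x = 1)) := by
    ext x
    simp only [mem_filter, hfun x]
  unfold winCount
  rw [hset]
  exact h

/-- **Junta strategies lose a constant fraction of the odd class — UNCONDITIONALLY** (`ringHardOdd_two` is a tree theorem). -/
theorem juntaHard :
    ∃ θ : ℝ, θ < 1 ∧ ∀ w₀ : ℕ, ∃ n₀ : ℕ, ∀ N ≥ n₀, ∀ (T : Fin N → Finset (Fin N)) (g : Fin N → (Fin N → Bool) → Bool),
      (∀ k, (T k).card ≤ w₀) → (∀ k, ReadsOnly (T k) (g k)) →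
        (winCount (fun x k => g k x) : ℝ) ≤ θ * (2 : ℝ) ^ (N - 1) :=
  juntaHardOfTwo ringHardOdd_two

/-! ## The bookkeeping implications -/

/-- **`FrameJuntaOfAveraging` PROVED**: `win ≤ avg_u win(z^{[u]}) + ε·2^{N−1} ≤ (θ₂ + ε)·2^{N−1}` with `ε = (1 − θ₂)/2`;
every frozen strategy is a `w₀`-junta strategy. -/
theorem frameJuntaOfAveraging : FrameJuntaOfAveraging := by
  intro hFA hJ hR δ hδ w₀
  obtain ⟨θ₂, hθ₂, hjunta⟩ := hJ hR
  obtain ⟨n₁, hn₁⟩ := hjunta w₀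
  set ε : ℝ := (1 - θ₂) / 2 with hε
  have hεpos : 0 < ε := by rw [hε]; linarith
  obtain ⟨μ₀, hμ₀, n₂, hn₂⟩ := hFA δ hδ w₀ ε hεpos
  refine ⟨μ₀, hμ₀, θ₂ + ε, by rw [hε]; linarith, max n₁ n₂, fun N hN m hm V T τ hreg hT hread => ?_⟩
  have hN₁ : n₁ ≤ N := le_trans (le_max_left _ _) hN
  have hN₂ : n₂ ≤ N := le_trans (le_max_right _ _) hN
  have havg := hn₂ N hN₂ m hm V T τ hreg hT hread
  -- every frozen strategy is a junta strategy
  have hfrozen : ∀ u : Fin m → ZMod 3, (winCount (frozenBell τ u) : ℝ) ≤ θ₂ * (2 : ℝ) ^ (N - 1) := by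
    intro u
    exact hn₁ N hN₁ T (fun k => τ k u) hT (fun k => hread k u)
  have hsum : (∑ u : Fin m → ZMod 3, (winCount (frozenBell τ u) : ℝ)) / (3 : ℝ) ^ m ≤ θ₂ * (2 : ℝ) ^ (N - 1) := by
    rw [div_le_iff₀ (by positivity)]
    calc ∑ u : Fin m → ZMod 3, (winCount (frozenBell τ u) : ℝ)
        ≤ ∑ _u : Fin m → ZMod 3, θ₂ * (2 : ℝ) ^ (N - 1) := sum_le_sum fun u _ => hfrozen u
      _ = θ₂ * (2 : ℝ) ^ (N - 1) * (3 : ℝ) ^ m := by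
          rw [sum_const, card_univ, Fintype.card_fun, ZMod.card, Fintype.card_fin, nsmul_eq_mul]
          push_cast
          ring
  calc (winCount (frameJuntaBell V τ) : ℝ)
      ≤ (∑ u : Fin m → ZMod 3, (winCount (frozenBell τ u) : ℝ)) / (3 : ℝ) ^ m + ε * (2 : ℝ) ^ (N - 1) := havg
    _ ≤ θ₂ * (2 : ℝ) ^ (N - 1) + ε * (2 : ℝ) ^ (N - 1) := by linarith
    _ = (θ₂ + ε) * (2 : ℝ) ^ (N - 1) := by ring

/-- **The rung modulo frame averaging**: `FrameAveraging → RingFrameJuntaLt3` (junta hardness and `RingHardOdd 2` are theorems). -/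
theorem ringFrameJuntaLt3_of (hFA : FrameAveraging) : RingFrameJuntaLt3 :=
  frameJuntaOfAveraging hFA juntaHardOfTwo ringHardOdd_two

/-- **`FrameJuntaOfCommon` PROVED** (take `J₀ = ∅`). -/
theorem frameJuntaOfCommon : FrameJuntaOfCommon := by
  intro hC δ hδ w₀
  obtain ⟨μ₀, hμ₀, θ, hθ, n₀, hn₀⟩ := hC δ hδ w₀ 0
  refine ⟨μ₀, hμ₀, θ, hθ, n₀, fun N hN m hm V T τ hreg hT hread => ?_⟩
  refine hn₀ N hN m hm V ∅ T τ (by simp) ?_ hT ?_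
  · intro t ht
    refine (hreg t ht).trans (le_of_eq ?_)
    congr 2
    exact filter_congr fun i _ => by simp
  · intro k y
    rw [Finset.union_empty]
    exact hread k y

end AffBells22

end Summit.QuantumAdvantage.AdviceFreeQNC0
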